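import Literature.Geometry.Riemannian.TwistorChartConnection
import HarnessLib

/-!
# Gauge covariance of the chart coupling form under a change of positive orthonormal frame
(topic `Geometry/Riemannian`; support for `exists_twistorSpace`, `TwistorPackage.lean`)

Continuing `TwistorChartConnection.lean` (chart `U : Opens E`, metric `g` with representative `G`,
`dim E = 4`). For TWO smooth `g`-orthonormal frame fields `ê, ê'` on `U` of the same orientation,
the transition map `T(y) = frameTransition g y (ê y) (ê' y) ∈ SO(3)` (`J_ζ(ê') = J_{T ζ}(ê)`,
`TwistorFrameChange.lean`) relates the connection forms `c = chartConn G ê`, `c' = chartConn G ê'`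
by the **gauge transformation law**

  `T(c'(u) × ζ) = (D_u T) ζ + c(u) × (T ζ)`     (`frameTransition_conn`),

proved by covariantly differentiating the identity `J_ζ(ê') = J_{Tζ}(ê)` of endomorphism-valued
functions: `∇_u J_ζ(ê) = J_{c(u) × ζ}(ê)` (`covDEnd_frameJ`, from the derivation lemma
`comm_frameComplexStructure` applied to the `g`-skew operator `A_u : ê_a ↦ ∇_u ê_a`). Together
with the tensorial law `T(Φ'(u,v)) = Φ(u,v)` for the curvature vectors (`frameTransition_curv`) and
`T ∈ SO(3)`, this gives the **gauge covariance of the model coupling scalar**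
(`modelScalar_gauge`): `Ω_{ê'}(y, η)(X₁, X₂) = Ω_{ê}(y, Tη)(Θ' X₁, Θ' X₂)` with
`Θ'(u, w) = (u, (D_u T) η + T w)` the differential of `(y, η) ↦ (y, T(y) η)` — i.e. the coupling
form of the twistor space does not depend on the frame used to write it (Fine–Panov 2009,
Prop. 2.1, where it is defined invariantly as a curvature form; FKP 2014, §4.1).

Everything here is proved; no named facts are introduced.

## References

* J. Fine, D. Panov, *Symplectic Calabi–Yau manifolds …*, J. Differential Geom. 82 (2009),
  Prop. 2.1. [FinePanov2009]
* J. Fine, K. Krasnov, D. Panov, *A gauge theoretic approach to Einstein 4-manifolds*,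
  New York J. Math. 20 (2014), §2.2, §4.1. [FineKrasnovPanov2014]
-/

noncomputable section

open scoped Matrix BigOperators Topology ContDiff Manifold
open Set Filter Function

namespace Literature.Geometry.Riemannian

open Literature.Geometry.Lorentzian (PseudoRiemannianMetric)
open Literature.Geometry.Lorentzian.PseudoRiemannianMetric
open Literature.Geometry.Lorentzian.MetricCoord

/-- Local notation: `ℝ³` as coordinate vectors. -/
local notation "R3" => (Fin 3 → ℝ)
/-- Local notation: Euclidean `ℝ³`. -/
local notation "E3" => EuclideanSpace ℝ (Fin 3)
/-- Local notation for the cross product. -/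
local infixl:74 " ×₃ " => crossProduct

variable {E : Type*} [NormedAddCommGroup E] [NormedSpace ℝ E]

/-! ### Covariant derivative of endomorphism-valued functions -/

section CovDEnd

variable (G : E → E →L[ℝ] E →L[ℝ] ℝ)

/-- **The covariant derivative of an endomorphism-valued function along the constant field `u`**:
`∇_u F = D_u F + Γ_u ∘ F - F ∘ Γ_u`, so that `∇_u (F p) = (∇_u F) p + F (∇_u p)` (`covDEnd_apply_covD`).
[folklore] -/
def covDEnd (u : E) (F : E → E →L[ℝ] E) (y : E) : E →L[ℝ] E :=
  fderiv ℝ F y u + (chrAt G y u).comp (F y) - (F y).comp (chrAt G y u)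

/-- **Leibniz rule** `∇_u (F p)(y) = (∇_u F)(y) (p y) + F(y) (∇_u p (y))`. [folklore] -/
theorem covD_clm_apply {u : E} {F : E → E →L[ℝ] E} {p : E → E} {y : E}
    (hF : DifferentiableAt ℝ F y) (hp : DifferentiableAt ℝ p y) :
    covD G u (fun y' ↦ F y' (p y')) y = covDEnd G u F y (p y) + F y (covD G u p y) := by
  rw [covD_apply, covD_apply, covDEnd, fderiv_clm_apply hF hp]
  simp only [_root_.add_apply, ContinuousLinearMap.comp_apply,
    ContinuousLinearMap.flip_apply, _root_.sub_apply, map_add]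
  abel

/-- Leibniz rule for a scalar factor: `∇_u (f F) = (D_u f) F + f ∇_u F`. [folklore] -/
theorem covDEnd_smul {u : E} {f : E → ℝ} {F : E → E →L[ℝ] E} {y : E}
    (hf : DifferentiableAt ℝ f y) (hF : DifferentiableAt ℝ F y) :
    covDEnd G u (fun y' ↦ f y' • F y') y = fderiv ℝ f y u • F y + f y • covDEnd G u F y := by
  simp only [covDEnd]
  rw [fderiv_fun_smul hf hF]
  ext w
  simp only [_root_.add_apply, _root_.smul_apply,
    _root_.sub_apply, ContinuousLinearMap.comp_apply,
    ContinuousLinearMap.smulRight_apply, map_smul]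
  module

/-- `covDEnd` of a finite sum. [folklore] -/
theorem covDEnd_sum {u : E} {ι : Type*} (s : Finset ι) {F : ι → E → E →L[ℝ] E} {y : E}
    (hF : ∀ i ∈ s, DifferentiableAt ℝ (F i) y) :
    covDEnd G u (fun y' ↦ ∑ i ∈ s, F i y') y = ∑ i ∈ s, covDEnd G u (F i) y := by
  simp only [covDEnd]
  rw [fderiv_fun_sum hF]
  simp only [FunLike.coe_sum, Finset.sum_apply, ContinuousLinearMap.comp_finsetSum,
    ContinuousLinearMap.finsetSum_comp, Finset.sum_add_distrib, Finset.sum_sub_distrib]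

/-- The bivector endomorphism `w ↦ G(a, w) b - G(b, w) a` built from the metric components
(`= bivectorEnd g y a b` when `g.val y = G y`). [cite: FineKrasnovPanov2014, §2.2] -/
def bivG (y : E) (a b : E) : E →L[ℝ] E :=
  (G y a).smulRight b - (G y b).smulRight a

/-- `bivG G y a b w = G(a, w) b - G(b, w) a`. [folklore] -/
@[simp] theorem bivG_apply (y a b w : E) : bivG G y a b w = G y a w • b - G y b w • a := rfl

variable {G} {V : Set E} {y : E}

/-- The bivector field of two differentiable vector functions is differentiable (as an
endomorphism-valued map; `smulRight` is bounded bilinear). [folklore] -/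
theorem differentiableAt_bivG (hG : IsMetricOn G V) (hy : y ∈ V) {p q : E → E}
    (hp : DifferentiableAt ℝ p y) (hq : DifferentiableAt ℝ q y) :
    DifferentiableAt ℝ (fun y' ↦ bivG G y' (p y') (q y')) y := by
  have hGd := hG.differentiableAt hy
  have hb := (isBoundedBilinearMap_smulRight (𝕜 := ℝ) (E := E) (F := E)).differentiableAt
  have h1 : DifferentiableAt ℝ (fun y' ↦ (G y' (p y')).smulRight (q y')) y :=
    (hb _).comp y ((hGd.clm_apply hp).prodMk hq)
  have h2 : DifferentiableAt ℝ (fun y' ↦ (G y' (q y')).smulRight (p y')) y :=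
    (hb _).comp y ((hGd.clm_apply hq).prodMk hp)
  exact h1.sub h2

/-- **`∇_u` is a derivation on bivectors**: `∇_u B(p, q) = B(∇_u p, q) + B(p, ∇_u q)` (metric
compatibility). [cite: FinePanov2009, §2.1] -/
theorem covDEnd_bivG (hG : IsMetricOn G V) (hy : y ∈ V) {p q : E → E} (u : E)
    (hp : DifferentiableAt ℝ p y) (hq : DifferentiableAt ℝ q y) :
    covDEnd G u (fun y' ↦ bivG G y' (p y') (q y')) y =
      bivG G y (covD G u p y) (q y) + bivG G y (p y) (covD G u q y) := by
  have hGd := hG.differentiableAt hy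
  have hF := differentiableAt_bivG hG hy hp hq
  ext w
  -- derivative of the scalar factors `y' ↦ G y' (r y') w`
  have hsd : ∀ {r : E → E}, DifferentiableAt ℝ r y →
      DifferentiableAt ℝ (fun y' ↦ G y' (r y') w) y := fun hr ↦
    (hGd.clm_apply hr).clm_apply (differentiableAt_const w)
  have hds : ∀ {r : E → E}, DifferentiableAt ℝ r y →
      fderiv ℝ (fun y' ↦ G y' (r y') w) y u = G y (covD G u r y) w + G y (r y) (chrAt G y u w) := by
    intro r hr
    have h := fderiv_metric_apply hG hy hr (differentiableAt_const w) u
    simp only [covD_apply, fderiv_fun_const, Pi.zero_apply, _root_.zero_apply,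
      zero_add] at h
    exact h
  -- evaluation at `w` commutes with the derivative
  have hev : fderiv ℝ (fun y' ↦ bivG G y' (p y') (q y')) y u w =
      fderiv ℝ (fun y' ↦ bivG G y' (p y') (q y') w) y u := by
    have h := (hasFDerivAt_clm_apply_const hF.hasFDerivAt w).fderiv
    rw [h, ContinuousLinearMap.flip_apply]
  have hfw : (fun y' ↦ bivG G y' (p y') (q y') w) =
      fun y' ↦ G y' (p y') w • q y' - G y' (q y') w • p y' := rfl
  have hdw : fderiv ℝ (fun y' ↦ bivG G y' (p y') (q y') w) y u =
      (G y (covD G u p y) w + G y (p y) (chrAt G y u w)) • q y + G y (p y) w • fderiv ℝ q y u -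
        ((G y (covD G u q y) w + G y (q y) (chrAt G y u w)) • p y + G y (q y) w • fderiv ℝ p y u) := by
    rw [hfw, fderiv_fun_sub ((hsd hp).fun_smul hq) ((hsd hq).fun_smul hp), fderiv_fun_smul (hsd hp) hq,
      fderiv_fun_smul (hsd hq) hp]
    simp only [_root_.sub_apply, _root_.add_apply,
      _root_.smul_apply, ContinuousLinearMap.smulRight_apply, hds hp, hds hq]
    abel
  show (fderiv ℝ (fun y' ↦ bivG G y' (p y') (q y')) y u + (chrAt G y u).comp (bivG G y (p y) (q y)) -
    (bivG G y (p y) (q y)).comp (chrAt G y u)) w = _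
  rw [_root_.sub_apply, _root_.add_apply, ContinuousLinearMap.comp_apply,
    ContinuousLinearMap.comp_apply, hev, hdw]
  simp only [bivG_apply, covD_apply, map_add, map_sub, map_smul, _root_.add_apply, add_smul,
    smul_add]
  module

/-- **The `ad` identity for bivectors**: for a `G`-skew `A`, `[A, B(a, b)] = B(A a, b) + B(a, A b)`.
[cite: FineKrasnovPanov2014, §2.2] -/
theorem comm_bivG {A : E →L[ℝ] E} (hA : ∀ v w, G y (A v) w + G y (A w) v = 0)
    (hs : ∀ v w, G y v w = G y w v) (a b : E) :
    A.comp (bivG G y a b) - (bivG G y a b).comp A = bivG G y (A a) b + bivG G y a (A b) := by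
  ext w
  have h1 : G y a (A w) = -G y (A a) w := by linarith [hA a w, hs a (A w)]
  have h2 : G y b (A w) = -G y (A b) w := by linarith [hA b w, hs b (A w)]
  simp only [_root_.sub_apply, _root_.add_apply, ContinuousLinearMap.comp_apply, bivG_apply,
    map_sub, map_smul, h1, h2]
  module

end CovDEnd

/-! ### The frame endomorphisms `J_ζ(ê)` as functions on the chart -/

section FrameJ

variable (G : E → E →L[ℝ] E →L[ℝ] ℝ) (ê : Fin 4 → E → E)

/-- **`J_ζ(ê)` built from the metric components**: `Σᵢ ζᵢ Σ_{(a,b) ∈ φᵢ} B(ê_a, ê_b)`, an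
endomorphism-valued function on the chart (`= frameComplexStructure g y (ê y) ζ` on `U`,
`frameJG_eq`). [cite: FineKrasnovPanov2014, §2.2] -/
def frameJG (y : E) (ζ : R3) : E →L[ℝ] E :=
  ∑ i, ζ i • ∑ k, bivG G y (ê (selfDualIdx i k).1 y) (ê (selfDualIdx i k).2 y)

/-- `frameJG` is additive in `ζ`. [folklore] -/
theorem frameJG_add (y : E) (ζ ζ' : R3) :
    frameJG G ê y (ζ + ζ') = frameJG G ê y ζ + frameJG G ê y ζ' := by
  simp only [frameJG, Pi.add_apply, add_smul, Finset.sum_add_distrib]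

/-- `frameJG` is homogeneous in `ζ`. [folklore] -/
theorem frameJG_smul (y : E) (r : ℝ) (ζ : R3) :
    frameJG G ê y (r • ζ) = r • frameJG G ê y ζ := by
  simp only [frameJG, Pi.smul_apply, smul_eq_mul, mul_smul, Finset.smul_sum]

/-- `frameJG` of a finite sum. [folklore] -/
theorem frameJG_sum (y : E) {ι : Type*} (s : Finset ι) (f : ι → R3) :
    frameJG G ê y (∑ j ∈ s, f j) = ∑ j ∈ s, frameJG G ê y (f j) := by
  classical
  induction s using Finset.induction_on with
  | empty => simp [frameJG]
  | insert a s ha ih => rw [Finset.sum_insert ha, Finset.sum_insert ha, frameJG_add, ih]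

/-- `frameJG` as a sum over the basis: `Σᵢ ζᵢ J_i`. [folklore] -/
theorem frameJG_eq_sum (y : E) (ζ : R3) :
    frameJG G ê y ζ = ∑ i, ζ i • frameJG G ê y (Pi.single i 1) := by
  simp only [frameJG]
  refine Finset.sum_congr rfl fun i _ ↦ ?_
  rw [Finset.smul_sum, Finset.sum_eq_single i (fun j _ hj ↦ by simp [hj]) (fun h ↦ absurd (Finset.mem_univ i) h)]
  simp

/-- **The operator `A_u : w ↦ Σ_c G(ê_c, w) ∇_u ê_c`**, which sends `ê_a` to `∇_u ê_a` for an
orthonormal frame and is `G`-skew (`frameCovOp_skew`). [cite: FinePanov2009, §2.1] -/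
def frameCovOp (u : E) (y : E) : E →L[ℝ] E :=
  ∑ c, (G y (ê c y)).smulRight (covD G u (ê c) y)

/-- `frameCovOp G ê u y w = Σ_c G(ê_c, w) ∇_u ê_c`. [folklore] -/
theorem frameCovOp_apply (u y w : E) :
    frameCovOp G ê u y w = ∑ c, G y (ê c y) w • covD G u (ê c) y := by
  simp only [frameCovOp, FunLike.coe_sum, Finset.sum_apply, ContinuousLinearMap.smulRight_apply]

variable {G ê} {U : TopologicalSpace.Opens E}
  {g : PseudoRiemannianMetric 𝓘(ℝ, E) ∞ E (TangentSpace 𝓘(ℝ, E) : U → Type _)}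

/-- On `U`, `frameJG` is the tautological `frameComplexStructure` of the frame. [folklore] -/
theorem frameJG_eq (hG : ∀ y : U, g.val y = G y) (y : U) (ζ : R3) :
    frameJG G ê y ζ = frameComplexStructure g y (fun a ↦ ê a y) ζ := by
  simp only [frameJG, frameComplexStructure, selfDualPairs_eq]
  refine Finset.sum_congr rfl fun i _ ↦ ?_
  congr 1
  refine Finset.sum_congr rfl fun k _ ↦ ?_
  ext w
  simp only [bivG_apply, bivectorEnd, hG y]
  rfl

/-- `A_u ê_a = ∇_u ê_a` for an orthonormal frame. [folklore] -/
theorem frameCovOp_frame (hG : ∀ y : U, g.val y = G y)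
    (hon : ∀ y : U, g.IsOrthonormalFrame y (fun a ↦ ê a y)) (u : E) (y : U) (a : Fin 4) :
    frameCovOp G ê u y (ê a y) = covD G u (ê a) y := by
  classical
  rw [frameCovOp_apply]
  have h : ∀ c, G y (ê c y) (ê a y) = if c = a then 1 else 0 := fun c ↦ by
    rw [← hG y]; exact (hon y).val_ite c a
  simp only [h, ite_smul, one_smul, zero_smul, Finset.sum_ite_eq', Finset.mem_univ, if_true]

variable [FiniteDimensional ℝ E] [CompleteSpace E]

omit [CompleteSpace E] in
/-- **`A_u` is `G`-skew** (skew-symmetry of the connection matrix and Parseval).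
[cite: FinePanov2009, §2.1] -/
theorem frameCovOp_skew (hG : ∀ y : U, g.val y = G y) (hE : Module.finrank ℝ E = 4)
    (hê : ∀ a, ContDiffOn ℝ ∞ (ê a) U) (hon : ∀ y : U, g.IsOrthonormalFrame y (fun a ↦ ê a y))
    (u : E) (y : U) (v w : E) :
    G y (frameCovOp G ê u y v) w + G y (frameCovOp G ê u y w) v = 0 := by
  have hGm := Literature.Geometry.Lorentzian.OpensChart.isMetricOn_repr hG
  have hy : (y : E) ∈ (U : Set E) := y.2
  have hs := hGm.symm y hy
  have hP : ∀ a b : E, G y a b = ∑ c, G y a (ê c y) * G y b (ê c y) := fun a b ↦ by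
    have h := val_eq_sum_mul (hon y) hE a b
    rw [hG y] at h
    exact h
  have hsk := metric_covD_frame_add hG hê hon y u
  simp only [frameCovOp_apply, map_sum, map_smul, FunLike.coe_sum, Finset.sum_apply,
    FunLike.coe_smul, Pi.smul_apply, smul_eq_mul]
  have h1 : ∑ c, G y (ê c y) v * G y (covD G u (ê c) y) w =
      ∑ c, ∑ a, G y v (ê c y) * G y w (ê a y) * G y (covD G u (ê c) y) (ê a y) := by
    refine Finset.sum_congr rfl fun c _ ↦ ?_
    rw [hP (covD G u (ê c) y) w, Finset.mul_sum]
    refine Finset.sum_congr rfl fun a _ ↦ ?_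
    rw [hs (ê c y) v, hs w (ê a y)]
    ring
  have h2 : ∑ c, G y (ê c y) w * G y (covD G u (ê c) y) v =
      ∑ c, ∑ a, G y v (ê c y) * G y w (ê a y) * G y (covD G u (ê a) y) (ê c y) := by
    rw [Finset.sum_comm]
    refine Finset.sum_congr rfl fun a _ ↦ ?_
    rw [hP (covD G u (ê a) y) v, Finset.mul_sum]
    refine Finset.sum_congr rfl fun c _ ↦ ?_
    rw [hs (ê a y) w, hs v (ê c y)]
    ring
  rw [h1, h2, ← Finset.sum_add_distrib]
  refine Finset.sum_eq_zero fun c _ ↦ ?_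
  rw [← Finset.sum_add_distrib]
  refine Finset.sum_eq_zero fun a _ ↦ ?_
  have h := hsk c a
  have : G y v (ê c y) * G y w (ê a y) * G y (covD G u (ê c) y) (ê a y) +
      G y v (ê c y) * G y w (ê a y) * G y (covD G u (ê a) y) (ê c y) =
      G y v (ê c y) * G y w (ê a y) *
        (G y (covD G u (ê c) y) (ê a y) + G y (covD G u (ê a) y) (ê c y)) := by ring
  rw [this, h, mul_zero]

omit [CompleteSpace E] in
/-- **The covariant derivative of the frame endomorphisms**: `∇_u J_ζ(ê) = J_{c(u) × ζ}(ê)` on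
`U`, `c = chartConnVec G ê` (derivation lemma `comm_frameComplexStructure` for `A_u`).
[cite: FinePanov2009, §2.1] -/
theorem covDEnd_frameJG (hG : ∀ y : U, g.val y = G y) (hE : Module.finrank ℝ E = 4)
    (hê : ∀ a, ContDiffOn ℝ ∞ (ê a) U) (hon : ∀ y : U, g.IsOrthonormalFrame y (fun a ↦ ê a y))
    (y : U) (u : E) (ζ : R3) :
    covDEnd G u (fun y' ↦ frameJG G ê y' ζ) y = frameJG G ê y (chartConnVec G ê y u ×₃ ζ) := by
  have hGm := Literature.Geometry.Lorentzian.OpensChart.isMetricOn_repr hG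
  have hy : (y : E) ∈ (U : Set E) := y.2
  have hde : ∀ a, DifferentiableAt ℝ (ê a) y := fun a ↦
    (((hê a) y hy).contDiffAt (hGm.mem_nhds hy)).differentiableAt (by simp)
  have hdb : ∀ i k, DifferentiableAt ℝ
      (fun y' ↦ bivG G y' (ê (selfDualIdx i k).1 y') (ê (selfDualIdx i k).2 y')) y :=
    fun i k ↦ differentiableAt_bivG hGm hy (hde _) (hde _)
  -- compute `∇_u` term by term
  have h1 : covDEnd G u (fun y' ↦ frameJG G ê y' ζ) y =
      ∑ i, ζ i • ∑ k, (bivG G y (covD G u (ê (selfDualIdx i k).1) y) (ê (selfDualIdx i k).2 y) +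
        bivG G y (ê (selfDualIdx i k).1 y) (covD G u (ê (selfDualIdx i k).2) y)) := by
    have hF : (fun y' ↦ frameJG G ê y' ζ) = fun y' ↦ ∑ i, (fun y'' ↦ ζ i •
        ∑ k, bivG G y'' (ê (selfDualIdx i k).1 y'') (ê (selfDualIdx i k).2 y'')) y' := rfl
    rw [hF, covDEnd_sum G Finset.univ fun i _ ↦ ?_]
    · refine Finset.sum_congr rfl fun i _ ↦ ?_
      rw [covDEnd_smul G (differentiableAt_const _) (DifferentiableAt.fun_sum fun k _ ↦ hdb i k),
        fderiv_fun_const, Pi.zero_apply, _root_.zero_apply, zero_smul, zero_add]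
      congr 1
      have hF' : (fun y'' ↦ ∑ k, bivG G y'' (ê (selfDualIdx i k).1 y'') (ê (selfDualIdx i k).2 y'')) =
          fun y'' ↦ ∑ k, (fun z ↦ bivG G z (ê (selfDualIdx i k).1 z) (ê (selfDualIdx i k).2 z)) y'' :=
        rfl
      rw [hF', covDEnd_sum G Finset.univ fun k _ ↦ hdb i k]
      exact Finset.sum_congr rfl fun k _ ↦ covDEnd_bivG hGm hy u (hde _) (hde _)
    · exact (differentiableAt_const _).fun_smul (DifferentiableAt.fun_sum fun k _ ↦ hdb i k)
  -- the same sum is `[A_u, J_ζ]`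
  set A := frameCovOp G ê u y with hA
  have hAskew := frameCovOp_skew hG hE hê hon u y
  have hs := hGm.symm y hy
  have h2 : ∑ i, ζ i • ∑ k, (bivG G y (covD G u (ê (selfDualIdx i k).1) y) (ê (selfDualIdx i k).2 y) +
        bivG G y (ê (selfDualIdx i k).1 y) (covD G u (ê (selfDualIdx i k).2) y)) =
      A.comp (frameJG G ê y ζ) - (frameJG G ê y ζ).comp A := by
    simp only [frameJG, ContinuousLinearMap.comp_finsetSum, ContinuousLinearMap.finsetSum_comp,
      ContinuousLinearMap.comp_smul, ContinuousLinearMap.smul_comp, ← Finset.sum_sub_distrib,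
      ← smul_sub]
    refine Finset.sum_congr rfl fun i _ ↦ ?_
    congr 1
    refine Finset.sum_congr rfl fun k _ ↦ ?_
    rw [comm_bivG hAskew hs, frameCovOp_frame hG hon, frameCovOp_frame hG hon]
  -- the derivation lemma in the frame
  have h3 : A.comp (frameJG G ê y ζ) - (frameJG G ê y ζ).comp A =
      frameJG G ê y (chartConnVec G ê y u ×₃ ζ) := by
    have hA' : ∀ v w, g.val y (A v) w + g.val y (A w) v = 0 := fun v w ↦ by
      rw [hG y]; exact hAskew v w
    have hsd : selfDualVecOf g (x := y) (fun a ↦ ê a y) A = chartConnVec G ê y u := by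
      ext i
      simp only [selfDualVecOf, selfDualPairs_eq, chartConnVec, hG y, hA]
      refine Finset.sum_congr rfl fun k _ ↦ ?_
      erw [frameCovOp_frame hG hon u y (selfDualIdx i k).1, hs]
    rw [frameJG_eq hG, frameJG_eq hG, ← hsd]
    exact comm_frameComplexStructure (hon y) hE hA' ζ
  rw [h1, h2, h3]

omit [CompleteSpace E] in
/-- `frameJG` of the basis vectors is differentiable at points of `U`. [folklore] -/
theorem differentiableAt_frameJG (hG : ∀ y : U, g.val y = G y)
    (hê : ∀ a, ContDiffOn ℝ ∞ (ê a) U) (y : U) (ζ : R3) :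
    DifferentiableAt ℝ (fun y' ↦ frameJG G ê y' ζ) y := by
  have hGm := Literature.Geometry.Lorentzian.OpensChart.isMetricOn_repr hG
  have hy : (y : E) ∈ (U : Set E) := y.2
  have hde : ∀ a, DifferentiableAt ℝ (ê a) y := fun a ↦
    (((hê a) y hy).contDiffAt (hGm.mem_nhds hy)).differentiableAt (by simp)
  simp only [frameJG]
  refine DifferentiableAt.fun_sum fun i _ ↦ (differentiableAt_const _).fun_smul ?_
  exact DifferentiableAt.fun_sum fun k _ ↦ differentiableAt_bivG hGm hy (hde _) (hde _)

omit [CompleteSpace E] in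
/-- **Leibniz form of `∇_u J_ξ(ê)` for a varying `ξ`**: `∇_u J_{ξ}(ê) = J_{D_u ξ + c(u) × ξ}(ê)`.
[cite: FinePanov2009, §2.1] -/
theorem covDEnd_frameJG_of_fun (hG : ∀ y : U, g.val y = G y) (hE : Module.finrank ℝ E = 4)
    (hê : ∀ a, ContDiffOn ℝ ∞ (ê a) U) (hon : ∀ y : U, g.IsOrthonormalFrame y (fun a ↦ ê a y))
    (y : U) (u : E) {ξ : E → R3} (hξ : DifferentiableAt ℝ ξ y) :
    covDEnd G u (fun y' ↦ frameJG G ê y' (ξ y')) y =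
      frameJG G ê y (fderiv ℝ ξ y u + chartConnVec G ê y u ×₃ ξ y) := by
  have hJ : ∀ i, DifferentiableAt ℝ (fun y' ↦ frameJG G ê y' (Pi.single i 1)) y := fun i ↦
    differentiableAt_frameJG hG hê y _
  have hξi : ∀ i, DifferentiableAt ℝ (fun y' ↦ ξ y' i) y := fun i ↦
    (ContinuousLinearMap.proj (R := ℝ) (φ := fun _ : Fin 3 ↦ ℝ) i).differentiableAt.comp (y : E) hξ
  have hdi : ∀ i, fderiv ℝ (fun y' ↦ ξ y' i) y u = fderiv ℝ ξ y u i := fun i ↦ by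
    have h := ((ContinuousLinearMap.proj (R := ℝ) (φ := fun _ : Fin 3 ↦ ℝ) i).hasFDerivAt.comp
      (y : E) hξ.hasFDerivAt).fderiv
    have h' : (fun y' ↦ ξ y' i) =
        (⇑(ContinuousLinearMap.proj (R := ℝ) (φ := fun _ : Fin 3 ↦ ℝ) i) ∘ ξ) := rfl
    rw [h', h]; rfl
  have hF : (fun y' ↦ frameJG G ê y' (ξ y')) =
      fun y' ↦ ∑ i, (fun z ↦ ξ z i • frameJG G ê z (Pi.single i 1)) y' := by
    funext y'; exact frameJG_eq_sum G ê y' (ξ y')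
  rw [hF, covDEnd_sum G Finset.univ fun i _ ↦ (hξi i).fun_smul (hJ i)]
  have h2 : ∀ i, covDEnd G u (fun z ↦ ξ z i • frameJG G ê z (Pi.single i 1)) y =
      fderiv ℝ ξ y u i • frameJG G ê y (Pi.single i 1) +
        ξ y i • frameJG G ê y (chartConnVec G ê y u ×₃ Pi.single i 1) := fun i ↦ by
    rw [covDEnd_smul G (hξi i) (hJ i), hdi, covDEnd_frameJG hG hE hê hon]
  simp only [h2, Finset.sum_add_distrib]
  rw [frameJG_add, ← frameJG_eq_sum]
  congr 1
  have hξsum : ξ y = ∑ i, ξ y i • (Pi.single i (1 : ℝ) : R3) := by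
    ext j
    simp [Finset.sum_apply, Pi.single_apply]
  conv_rhs => rw [hξsum]
  simp only [map_sum, map_smul, frameJG_sum, frameJG_smul]

omit [FiniteDimensional ℝ E] [CompleteSpace E] in
/-- **`ζ ↦ J_ζ(ê)` is injective** on `U` (read `ζₘ = G(J_ζ ê₀, ê_{m+1})`). [folklore] -/
theorem frameJG_injective (hG : ∀ y : U, g.val y = G y)
    (hon : ∀ y : U, g.IsOrthonormalFrame y (fun a ↦ ê a y)) (y : U) {ζ ζ' : R3}
    (h : frameJG G ê y ζ = frameJG G ê y ζ') : ζ = ζ' := by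
  rw [frameJG_eq hG, frameJG_eq hG] at h
  rw [← frameTransition_self (hon y) ζ, ← frameTransition_self (hon y) ζ']
  ext m
  rw [frameTransition_apply, frameTransition_apply, h]

end FrameJ

/-! ### The transition map between two frames, as a function on the chart -/

section Trans

variable (G : E → E →L[ℝ] E →L[ℝ] ℝ) (ê ê' : Fin 4 → E → E)

/-- The vectors `wᵢ(y) ∈ ℝ³`, `(wᵢ)ₘ = Σ_{(p,q) ∈ φᵢ(ê')} (G(ê'_p, ê₀) G(ê'_q, ê_{m+1}) -
G(ê'_q, ê₀) G(ê'_p, ê_{m+1}))`, the columns of the transition matrix. [folklore] -/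
def chartTransCol (y : E) (i : Fin 3) : R3 := fun m ↦
  ∑ k, (G y (ê' (selfDualIdx i k).1 y) (ê 0 y) * G y (ê' (selfDualIdx i k).2 y) (ê m.succ y) -
    G y (ê' (selfDualIdx i k).2 y) (ê 0 y) * G y (ê' (selfDualIdx i k).1 y) (ê m.succ y))

/-- **The transition map of the twistor fibre between the frames `ê, ê'`** as a function on the
chart: `T(y) ζ = Σᵢ ζᵢ wᵢ(y)`, equal on `U` to `frameTransition g y (ê y) (ê' y)`
(`chartTrans_eq`), so that `J_ζ(ê') = J_{T ζ}(ê)`. [cite: AtiyahHitchinSinger1978, §1] -/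
def chartTrans (y : E) : R3 →L[ℝ] R3 :=
  LinearMap.toContinuousLinearMap
    { toFun := fun ζ ↦ ∑ i, ζ i • chartTransCol G ê ê' y i
      map_add' := fun ζ η ↦ by simp only [Pi.add_apply, add_smul, Finset.sum_add_distrib]
      map_smul' := fun r ζ ↦ by
        simp only [Pi.smul_apply, smul_eq_mul, mul_smul, Finset.smul_sum, RingHom.id_apply] }

/-- Unfolding `chartTrans`. [folklore] -/
theorem chartTrans_apply (y : E) (ζ : R3) :
    chartTrans G ê ê' y ζ = ∑ i, ζ i • chartTransCol G ê ê' y i := rfl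

variable {G ê ê'} {U : TopologicalSpace.Opens E}
  {g : PseudoRiemannianMetric 𝓘(ℝ, E) ∞ E (TangentSpace 𝓘(ℝ, E) : U → Type _)}

/-- On `U`, `chartTrans` is `frameTransition`. [folklore] -/
theorem chartTrans_eq (hG : ∀ y : U, g.val y = G y) (y : U) (ζ : R3) :
    chartTrans G ê ê' y ζ = frameTransition g y (fun a ↦ ê a y) (fun a ↦ ê' a y) ζ := by
  ext m
  simp only [chartTrans_apply, Finset.sum_apply, Pi.smul_apply, smul_eq_mul, chartTransCol,
    frameTransition_apply, frameComplexStructure, FunLike.coe_sum, FunLike.coe_smul,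
    selfDualPairs_eq, bivectorEnd_apply, map_sum, map_smul, map_sub, FunLike.coe_sub,
    Pi.sub_apply, hG y]
  rfl

variable [FiniteDimensional ℝ E]

omit [FiniteDimensional ℝ E] in
/-- **The transition map is smooth** on `U`. [folklore] -/
theorem contDiffOn_chartTrans {V : Set E} (hGm : IsMetricOn G V) (hê : ∀ a, ContDiffOn ℝ ∞ (ê a) V)
    (hê' : ∀ a, ContDiffOn ℝ ∞ (ê' a) V) : ContDiffOn ℝ ∞ (chartTrans G ê ê') V := by
  refine contDiffOn_clm_apply.2 fun ζ ↦ ?_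
  have h : (fun y ↦ chartTrans G ê ê' y ζ) = fun y ↦ ∑ i, ζ i • chartTransCol G ê ê' y i := rfl
  rw [h]
  have hp : ∀ a c, ContDiffOn ℝ ∞ (fun y ↦ G y (ê' a y) (ê c y)) V := fun a c ↦
    (hGm.contDiffOn.clm_apply (hê' a)).clm_apply (hê c)
  have hcol : ∀ i, ContDiffOn ℝ ∞ (fun y ↦ chartTransCol G ê ê' y i) V := fun i ↦ by
    refine contDiffOn_pi.2 fun m ↦ ?_
    refine ContDiffOn.sum fun k _ ↦ ?_
    exact ((hp _ _).mul (hp _ _)).sub ((hp _ _).mul (hp _ _))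
  exact ContDiffOn.sum fun i _ ↦ ContDiffOn.fun_smul contDiffOn_const (hcol i)

variable [CompleteSpace E]

omit [CompleteSpace E] in
/-- `J_v(ê') = J_{T v}(ê)` for like-oriented orthonormal frames, in the chart. [cite: AtiyahHitchinSinger1978, §1] -/
theorem frameJG_eq_frameJG_chartTrans (hG : ∀ y : U, g.val y = G y) (hE : Module.finrank ℝ E = 4)
    (hon : ∀ y : U, g.IsOrthonormalFrame y (fun a ↦ ê a y))
    (hon' : ∀ y : U, g.IsOrthonormalFrame y (fun a ↦ ê' a y))
    (hvol : ∀ y : U, ∃ vol : E [⋀^Fin 4]→ₗ[ℝ] ℝ, 0 < vol (fun a ↦ ê a y) * vol (fun a ↦ ê' a y))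
    (y : U) (v : R3) : frameJG G ê' y v = frameJG G ê y (chartTrans G ê ê' y v) := by
  obtain ⟨vol, hv⟩ := hvol y
  rw [frameJG_eq hG, frameJG_eq hG, chartTrans_eq hG,
    frameComplexStructure_frameChange (hon y) (hon' y) hE vol hv]

omit [CompleteSpace E] in
/-- **The gauge transformation law of the connection forms**:
`T(c'(u) × ζ) = (D_u T) ζ + c(u) × (T ζ)` for the connection vectors `c, c'` of `Λ⁺` in two
smooth like-oriented orthonormal frames (covariantly differentiate `J_ζ(ê') = J_{Tζ}(ê)`).
[cite: FineKrasnovPanov2014, §2.2] -/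
theorem chartTrans_conn (hG : ∀ y : U, g.val y = G y) (hE : Module.finrank ℝ E = 4)
    (hê : ∀ a, ContDiffOn ℝ ∞ (ê a) U) (hê' : ∀ a, ContDiffOn ℝ ∞ (ê' a) U)
    (hon : ∀ y : U, g.IsOrthonormalFrame y (fun a ↦ ê a y))
    (hon' : ∀ y : U, g.IsOrthonormalFrame y (fun a ↦ ê' a y))
    (hvol : ∀ y : U, ∃ vol : E [⋀^Fin 4]→ₗ[ℝ] ℝ, 0 < vol (fun a ↦ ê a y) * vol (fun a ↦ ê' a y))
    (y : U) (u : E) (ζ : R3) :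
    chartTrans G ê ê' y (chartConnVec G ê' y u ×₃ ζ) =
      fderiv ℝ (chartTrans G ê ê') y u ζ + chartConnVec G ê y u ×₃ chartTrans G ê ê' y ζ := by
  have hGm := Literature.Geometry.Lorentzian.OpensChart.isMetricOn_repr hG
  have hy : (y : E) ∈ (U : Set E) := y.2
  have hT : DifferentiableAt ℝ (chartTrans G ê ê') y :=
    (((contDiffOn_chartTrans hGm hê hê') y hy).contDiffAt (hGm.mem_nhds hy)).differentiableAt
      (by simp)
  have hξ : DifferentiableAt ℝ (fun y' ↦ chartTrans G ê ê' y' ζ) y := hT.clm_apply (differentiableAt_const ζ)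
  -- the two endomorphism-valued functions agree near `y`
  have heq : (fun y' ↦ frameJG G ê' y' ζ) =ᶠ[𝓝 (y : E)] fun y' ↦ frameJG G ê y' (chartTrans G ê ê' y' ζ) := by
    filter_upwards [hGm.mem_nhds hy] with y' hy'
    exact frameJG_eq_frameJG_chartTrans hG hE hon hon' hvol ⟨y', hy'⟩ ζ
  have hc : covDEnd G u (fun y' ↦ frameJG G ê' y' ζ) y =
      covDEnd G u (fun y' ↦ frameJG G ê y' (chartTrans G ê ê' y' ζ)) y := by
    simp only [covDEnd, heq.fderiv_eq, heq.self_of_nhds]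
  rw [covDEnd_frameJG hG hE hê' hon' y u ζ, covDEnd_frameJG_of_fun hG hE hê hon y u hξ,
    frameJG_eq_frameJG_chartTrans hG hE hon hon' hvol y] at hc
  have hd : fderiv ℝ (fun y' ↦ chartTrans G ê ê' y' ζ) y u = fderiv ℝ (chartTrans G ê ê') y u ζ := by
    rw [(hasFDerivAt_clm_apply_const hT.hasFDerivAt ζ).fderiv, ContinuousLinearMap.flip_apply]
  rw [hd] at hc
  exact frameJG_injective hG hon y hc

omit [FiniteDimensional ℝ E] [CompleteSpace E] in
/-- Two vectors with the same cross product with everything are equal. [folklore] -/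
theorem eq_of_forall_cross_eq {a b : R3} (h : ∀ w : R3, a ×₃ w = b ×₃ w) : a = b := by
  have h0 := h ![1, 0, 0]
  have h1 := h ![0, 1, 0]
  simp only [cross_apply] at h0 h1
  have e1 := congrFun h0 1; have e2 := congrFun h0 2; have e0 := congrFun h1 2
  simp at e0 e1 e2
  ext i; fin_cases i
  · simpa using e0
  · simpa using e2
  · simpa using e1

/-- **The curvature vectors transform tensorially**: `T(Φ'(u,v)) = Φ(u,v)` (both are the
`Λ⁺`-vectors of the `G`-skew curvature endomorphism `R(u,v)`, in the two frames; `T ∈ SO(3)`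
preserves the cross product). [cite: FineKrasnovPanov2014, §2.2] -/
theorem chartTrans_curv (hG : ∀ y : U, g.val y = G y) (hE : Module.finrank ℝ E = 4)
    (hon : ∀ y : U, g.IsOrthonormalFrame y (fun a ↦ ê a y))
    (hon' : ∀ y : U, g.IsOrthonormalFrame y (fun a ↦ ê' a y))
    (hvol : ∀ y : U, ∃ vol : E [⋀^Fin 4]→ₗ[ℝ] ℝ, 0 < vol (fun a ↦ ê a y) * vol (fun a ↦ ê' a y))
    (y : U) (u v : E) :
    chartTrans G ê ê' y (chartCurvVec G ê' y u v) = chartCurvVec G ê y u v := by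
  have hGm := Literature.Geometry.Lorentzian.OpensChart.isMetricOn_repr hG
  have hy : (y : E) ∈ (U : Set E) := y.2
  obtain ⟨vol, hv⟩ := hvol y
  have hv' : 0 < vol (fun a ↦ ê' a y) * vol (fun a ↦ ê a y) := by rwa [mul_comm]
  set R := riemAt G y u v with hR
  have hRskewG : ∀ a b : E, G y (R a) b + G y (R b) a = 0 := fun a b ↦ by
    have h := hGm.apply_riemAt_swap hy u v a b
    simp only [hR]
    linarith [h]
  have hRskew : ∀ a b : E, g.val y (R a) b + g.val y (R b) a = 0 := fun a b ↦ by
    rw [hG y]; exact hRskewG a b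
  -- `Λ⁺`-vectors of `R` in the two frames
  have hΦ : selfDualVecOf g (x := y) (fun a ↦ ê a y) R = chartCurvVec G ê y u v := by
    ext i; simp only [selfDualVecOf, selfDualPairs_eq, chartCurvVec, hG y]; rfl
  have hΦ' : selfDualVecOf g (x := y) (fun a ↦ ê' a y) R = chartCurvVec G ê' y u v := by
    ext i; simp only [selfDualVecOf, selfDualPairs_eq, chartCurvVec, hG y]; rfl
  have h1 := comm_frameComplexStructure (hon y) hE hRskew
  have h2 := comm_frameComplexStructure (hon' y) hE hRskew
  -- compare `[R, J_ζ(ê')]` computed in both frames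
  have key : ∀ ζ : R3, chartTrans G ê ê' y (chartCurvVec G ê' y u v) ×₃ chartTrans G ê ê' y ζ =
      chartCurvVec G ê y u v ×₃ chartTrans G ê ê' y ζ := by
    intro ζ
    have hx := (frameTransition_dotProduct_crossProduct (hon y) (hon' y) hE vol hv
      (chartCurvVec G ê' y u v) ζ).2
    have e2 := h2 ζ
    rw [hΦ', frameComplexStructure_frameChange (hon y) (hon' y) hE vol hv ζ,
      frameComplexStructure_frameChange (hon y) (hon' y) hE vol hv, hx, h1, hΦ] at e2
    rw [chartTrans_eq hG, chartTrans_eq hG]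
    have hinj := frameJG_injective (ê := ê) hG hon y (ζ := chartCurvVec G ê y u v ×₃ _)
      (ζ' := frameTransition g y _ _ (chartCurvVec G ê' y u v) ×₃ _)
      (by rw [frameJG_eq hG, frameJG_eq hG]; exact e2)
    exact hinj.symm
  refine eq_of_forall_cross_eq fun w ↦ ?_
  have hsurj : chartTrans G ê ê' y (frameTransition g y (fun a ↦ ê' a y) (fun a ↦ ê a y) w) = w := by
    rw [chartTrans_eq hG, frameTransition_frameTransition (hon y) (hon' y) (hon y) hE vol hv hv',
      frameTransition_self (hon y)]
  have h := key (frameTransition g y (fun a ↦ ê' a y) (fun a ↦ ê a y) w)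
  rwa [hsurj] at h

/-- **Gauge covariance of the model coupling scalar.** For two smooth like-oriented orthonormal
frame fields on `U` with transition map `T = chartTrans G ê ê'` and connection forms
`c = chartConn G ê`, `c' = chartConn G ê'`: at `y ∈ U`,
`Ω_{c'}(y, η)(X₁, X₂) = Ω_{c}(y, T η)(Θ' X₁, Θ' X₂)`, `Θ'(u, w) = (u, (D_u T) η + T w)` — the
coupling scalar written in the frame `ê'` is the pull-back of the one written in the frame `ê`
along the transition map `(y, η) ↦ (y, T(y) η)` (whose differential is `Θ'`). Ingredients: the
gauge law `chartTrans_conn` (`θ_c(Θ' X) = T θ_{c'}(X)`), the structure equations and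
`chartTrans_curv` (`F_c = T F_{c'}`), and `T ∈ SO(3)`. [cite: FinePanov2009, Prop. 2.1] -/
theorem modelScalar_gauge (hG : ∀ y : U, g.val y = G y) (hE : Module.finrank ℝ E = 4)
    (hê : ∀ a, ContDiffOn ℝ ∞ (ê a) U) (hê' : ∀ a, ContDiffOn ℝ ∞ (ê' a) U)
    (hon : ∀ y : U, g.IsOrthonormalFrame y (fun a ↦ ê a y))
    (hon' : ∀ y : U, g.IsOrthonormalFrame y (fun a ↦ ê' a y))
    (hvol : ∀ y : U, ∃ vol : E [⋀^Fin 4]→ₗ[ℝ] ℝ, 0 < vol (fun a ↦ ê a y) * vol (fun a ↦ ê' a y))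
    (y : U) (η : E3) (X₁ X₂ : E × E3) :
    modelScalar (chartConn G ê') ((y : E), η) X₁ X₂ =
      modelScalar (chartConn G ê) ((y : E), WithLp.toLp 2 (chartTrans G ê ê' y (WithLp.ofLp η)))
        (X₁.1, WithLp.toLp 2 (fderiv ℝ (chartTrans G ê ê') y X₁.1 (WithLp.ofLp η) +
          chartTrans G ê ê' y (WithLp.ofLp X₁.2)))
        (X₂.1, WithLp.toLp 2 (fderiv ℝ (chartTrans G ê ê') y X₂.1 (WithLp.ofLp η) +
          chartTrans G ê ê' y (WithLp.ofLp X₂.2))) := by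
  obtain ⟨vol, hv⟩ := hvol y
  set T := chartTrans G ê ê' y with hT
  -- `T` preserves the dot and the cross product
  have hTe : ∀ ζ, T ζ = frameTransition g y (fun a ↦ ê a y) (fun a ↦ ê' a y) ζ := fun ζ ↦ by
    rw [hT, chartTrans_eq hG]
  have hTP : ∀ a b : R3, T a ⬝ᵥ T b = a ⬝ᵥ b ∧ T (a ×₃ b) = T a ×₃ T b := fun a b ↦ by
    have h := frameTransition_dotProduct_crossProduct (hon y) (hon' y) hE vol hv a b
    simp only [← hTe] at h
    exact h
  -- `θ_c(Θ' X) = T θ_{c'}(X)`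
  have hθ : ∀ X : E × E3,
      modelTheta (chartConn G ê) ((y : E), WithLp.toLp 2 (T (WithLp.ofLp η)))
        (X.1, WithLp.toLp 2 (fderiv ℝ (chartTrans G ê ê') y X.1 (WithLp.ofLp η) +
          T (WithLp.ofLp X.2))) =
      T (modelTheta (chartConn G ê') ((y : E), η) X) := fun X ↦ by
    have hg := chartTrans_conn hG hE hê hê' hon hon' hvol y X.1 (WithLp.ofLp η)
    simp only [modelTheta, chartConn_apply, map_add]
    rw [← hT] at hg
    rw [hg]
    abel
  -- `F_c = T F_{c'}`
  have hF : modelCurv (chartConn G ê) y X₁.1 X₂.1 = T (modelCurv (chartConn G ê') y X₁.1 X₂.1) := by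
    rw [modelCurv_chartConn hG hE hê hon y, modelCurv_chartConn hG hE hê' hon' y, hT,
      chartTrans_curv hG hE hon hon' hvol y]
  rw [modelScalar, modelScalar, hθ X₁, hθ X₂]
  rw [hF, ← (hTP _ _).2, (hTP _ _).1, (hTP _ _).1, (hTP _ _).1]

end Trans

end Literature.Geometry.Riemannian
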